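import Summits.BirchSwinnertonDyer.BirchSwinnertonDyer.Theorems.CMKolyvaginAtInertTwoFrobeniusTwoTorsionAtTwo
import Summits.BirchSwinnertonDyer.BirchSwinnertonDyer.Theorems.AdditiveKolyvaginRoadKolyvaginGrossBridge
import HarnessLib

/-!
# Route `CMKolyvaginAtInertTwo`, crux `CMKolyvaginExactAtInertTwo` (stmt-BirchSwinnertonDyer-24277):
# THE FROBENIUS-FORM BRIDGE AT `p = 2`, DEPTH `1` — the route's typed Kolyvagin primes
# (`Zhang2014.IsKolyvaginPrime N_E W K 2 ℓ ∧ Rank1Residual.CMInert W ℓ`, rev 8) are GROSS'S Kolyvagin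
# primes (`Frob(ℓ) = Frob(∞)` in `Gal(K(E[2])/ℚ)`, the tree's `FrobEqFrobInfty W K (2^1) ℓ`)

Seat `bsd-line-cmk2-p1` g3 (cell `bsd-print-cf2`), `--supports stmt-BirchSwinnertonDyer-24277`
(helper; also serves the supply crux 24276 and route GenusKolyvaginAtTwo's 22137 on its `Δ < 0`
members). THEOREMS ONLY: no definition, no named fact, no `sorry`. Nothing here is about `Ш`; no
item is closed; BSD is not proved by any of this. Part 2 of 2 (part 1:
`CMKolyvaginAtInertTwoFrobeniusTwoTorsionAtTwo.lean` — `Frob_ℓ` moves a `2`-torsion point when `ℓ`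
is inert in `ℚ(√Δ_E)`).

WHY. Gross's §§3–9 apparatus and the tree's Kolyvagin machine
(`KolyvaginDescent.pow_smul_sha_primary_eq_zero_at_of_pointsM_of_reciprocityFinset` and its leaves)
consume Kolyvagin primes as `IsKolyvaginPrime N W K p ℓ` / `FrobEqFrobInfty W K (p^M) ℓ` (Frobenius
form); the route's cruxes type W. Zhang's congruence form at `p = 2` + `CMInert W ℓ`. For odd `p`
the bridge is `AdditiveKoly.frobEqFrobInfty_of_zhang_P` (`hp2 : p ≠ 2`); this file is its `p = 2`
counterpart at depth `M = 1` (`Gal(ℚ(E[2])/ℚ) ≅ GL₂(𝔽₂) ≅ S₃`).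

* §3 `exists_conj_smul_eq_of_transpositions_two` — two elements of `Γ_ℚ` acting on `E[2]` as
  involutions each moving some point (TRANSPOSITIONS in `S₃`) are conjugate on `E[2]` when
  `ρ̄_{E,2}` is onto: `{au+u, u}` and `{bu'+u', u'}` are `𝔽₂`-bases on which `a`, `b` have the same
  matrix; the conjugator lifts along `ρ̄`. (`p = 2` counterpart of
  `AdditiveKoly.exists_conj_smul_eq_of_involutions_P`, whose `±`-eigenbases need `p` odd.)
* §4 `frobEqFrobInfty_two_of_not_isSquare` — **Gross's (3.2) at `p = 2`**: `K` imaginary quadratic,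
  `ρ̄_{E,2}` onto, `Δ_E < 0` (so complex conjugation `c₀` is a transposition on `E[2]`: g2's
  `KolyvaginEigenTwo.exists_twoTorsion_smul_ne_of_Δ_neg`; `c₀² = 1`), `ℓ` a Zhang-Kolyvagin prime at
  `2` (`Frob_ℓ² = 1` on `E[2]` by Eichler–Shimura with `a_ℓ` even and `ℓ` odd: bsd-jet
  `GlobalDuality.frob_smul_frob_smul_eq_self_of_dvd`) with `Δ_E = d·s²`, `d` a non-square mod `ℓ`
  (part 1: `Frob_ℓ` moves a `2`-torsion point) ⟹ `FrobEqFrobInfty W K 2 ℓ`; on `K` both restrict to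
  the non-trivial automorphism (`ℓ` inert, `K` totally complex — verbatim the odd-`p` argument).
* §5 ON THE HABITAT H₂ (`HasCM`, `CMInert W 2`, `ρ̄₂` onto): `Δ = d_F·s²` with `d_F < 0`
  (lit g11 `exists_Δ_eq_mul_sq_of_cmInert_two` + g2 `Δ_neg_of_cmInert_two`), and `CMInert W ℓ` at
  odd `ℓ` says `d_F` is a non-square mod `ℓ`; hence **`frobEqFrobInfty_two_of_cmInert`:
  `Zhang2014.IsKolyvaginPrime (N_E) W K 2 ℓ ∧ CMInert W ℓ ⟹ FrobEqFrobInfty W K (2^1) ℓ`** and the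
  Gross-form `isKolyvaginPrime_two_pow_one_of_cmInert : … → IsKolyvaginPrime (N_E) W K (2^1) ℓ`.
  With p588641 (`CMKolyvaginPrimes.exists_isKolyvaginPrime_two_of_cmInert`: such `ℓ` exist beyond
  every bound at every depth) the line's «deep Kolyvagin primes for free» are Gross-form at depth 1,
  i.e. admissible input for every level-`2¹` statement of the machine.

NOT DONE HERE (honest): depth `M ≥ 2` (`FrobEqFrobInfty W K (2^M) ℓ` from `2^M ∣ ℓ+1`, `a_ℓ = 0`,
`ℓ` inert in `F`) needs the `2`-adic image of `G_F` (conjugacy of the non-Cartan involutions of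
`(O/2^M)ˣ ⋊ C₂` under the actual image; memo R6) and is not attempted.

References: [GrossLMS1991] §3 (3.1)–(3.3); [WZhang2014] Notations (xii); [SilvermanAEC2009] III.1,
V.2.3.1; [NeukirchANT1999] Ch. I §9 Prop. (9.4).
-/

-- single-conjunct summit: `Summit.BirchSwinnertonDyer.BirchSwinnertonDyer.…` repeats the name by design
set_option linter.dupNamespace false
set_option autoImplicit false

noncomputable section

open scoped Classical Pointwise

namespace Summit.BirchSwinnertonDyer.BirchSwinnertonDyer.Theorems.KolyvaginFrobeniusTwo

open WeierstrassCurve Field Function NumberField IsDedekindDomain Rat.HeightOneSpectrum Polynomial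
open Literature.NumberTheory.EllipticCurves Literature.NumberTheory.GaloisRepresentations Module
open Literature.NumberTheory.EllipticCurves.Rank1Residual
open Summit.BirchSwinnertonDyer.Rank1Residual.X11b.Three.Koly.Method2
open Summit.BirchSwinnertonDyer.Rank1Residual.JET
open Summit.BirchSwinnertonDyer.BirchSwinnertonDyer.Theorems.KolyvaginEigenTwo

/-! ## §3 Two transpositions of `E[2]` are conjugate under `Γ_ℚ` when `ρ̄_{E,2}` is onto -/

section Transpositions

variable (W : WeierstrassCurve ℚ) [W.IsElliptic]

/-- **Two involution-like elements of `Γ_ℚ` each moving a point of `E[2]` are conjugate on `E[2]`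
when `ρ̄_{E,2}` is onto.** If `a, b ∈ Γ_ℚ` satisfy `a² = 1 = b²` on `E[2]` and move `u`, resp.
`u'`, then `g a g⁻¹ = b` on `E[2]` for some `g ∈ Γ_ℚ`: `{a u + u, u}` and `{b u' + u', u'}` are
`𝔽₂`-bases of the plane `E[2]` on which `a`, `b` act by the same matrix (`a u = (a u + u) − u`),
and the conjugator `a u + u ↦ b u' + u'`, `u ↦ u'` lifts along the surjection `ρ̄ : Γ_ℚ → Aut E[2]`
(in `GL₂(𝔽₂) ≅ S₃`: any two transpositions are conjugate). The `p = 2` counterpart of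
`AdditiveKoly.exists_conj_smul_eq_of_involutions_P` (`p` odd, eigenbases). [folklore] -/
theorem exists_conj_smul_eq_of_transpositions_two
    (hsurj : W.HasSurjectiveModNGaloisRep ((2 : ℕ) : ℤ)) {a b : absoluteGaloisGroup ℚ}
    (ha2 : ∀ P : geomTorsion W ((2 : ℕ) : ℤ), a • a • P = P) {u : geomTorsion W ((2 : ℕ) : ℤ)}
    (hu : a • u ≠ u) (hb2 : ∀ P : geomTorsion W ((2 : ℕ) : ℤ), b • b • P = P)
    {u' : geomTorsion W ((2 : ℕ) : ℤ)} (hu' : b • u' ≠ u') :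
    ∃ g : absoluteGaloisGroup ℚ, ∀ P : geomTorsion W ((2 : ℕ) : ℤ), g • a • g⁻¹ • P = b • P := by
  letI : Module (ZMod 2) (geomTorsion W ((2 : ℕ) : ℤ)) := AddSubgroup.torsionBy.zmodModule
  have h2 : Module.finrank (ZMod 2) (geomTorsion W ((2 : ℕ) : ℤ)) = 2 :=
    Literature.RepresentationTheory.FiniteGroups.Representation.finrank_eq_two_of_natCard_eq_sq
      (card_torsionPoints_eq_sq_holds W (AlgebraicClosure ℚ) (n := 2) (by norm_num))
  haveI : FiniteDimensional (ZMod 2) (geomTorsion W ((2 : ℕ) : ℤ)) := Module.finite_of_finrank_eq_succ h2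
  -- the `ZMod 2`-linear maps of `a`, `b`
  set fa := (galoisRepTorsion W ((2 : ℕ) : ℤ) a).toAdd.toAddMonoidHom.toZModLinearMap 2 with hfadef
  set fb := (galoisRepTorsion W ((2 : ℕ) : ℤ) b).toAdd.toAddMonoidHom.toZModLinearMap 2 with hfbdef
  have hfa : ∀ Q, fa Q = a • Q := fun Q => rfl
  have hfb : ∀ Q, fb Q = b • Q := fun Q => rfl
  -- `{φ x + x, x}` is linearly independent when `φ² = 1` and `φ x ≠ x`
  have hli : ∀ (φ : geomTorsion W ((2 : ℕ) : ℤ) →ₗ[ZMod 2] geomTorsion W ((2 : ℕ) : ℤ))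
      {x : geomTorsion W ((2 : ℕ) : ℤ)}, (∀ P, φ (φ P) = P) → φ x ≠ x →
      LinearIndependent (ZMod 2) ![φ x + x, x] := by
    intro φ x hφ hx
    rw [LinearIndependent.pair_iff]
    intro c d hcd
    -- apply `φ`: `c • (x + φ x) + d • φ x = 0`; subtract: `d • (x - φ x) = 0`
    have hs : φ (c • (φ x + x) + d • x) = c • (φ x + x) + d • φ x := by
      rw [map_add, map_smul, map_smul, map_add, hφ, add_comm x (φ x)]
    rw [hcd, map_zero] at hs
    have hd0 : d • (x - φ x) = 0 := by
      have := congrArg₂ (· - ·) hcd hs.symm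
      simp only [sub_zero] at this
      rw [smul_sub]
      have e : c • (φ x + x) + d • x - (c • (φ x + x) + d • φ x) = d • x - d • φ x := by abel
      rw [← e, ← this]
    have hd : d = 0 := by
      rcases smul_eq_zero.mp hd0 with h | h
      · exact h
      · exact absurd (sub_eq_zero.mp h).symm hx
    rw [hd, zero_smul, add_zero] at hcd
    have hc : c = 0 := by
      rcases smul_eq_zero.mp hcd with h | h
      · exact h
      · exfalso; apply hx
        have hneg : φ x = -x := eq_neg_of_add_eq_zero_left h
        rw [hneg]; exact neg_eq_self_of_twoTorsion W x
    exact ⟨hc, hd⟩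
  have hcard : Fintype.card (Fin 2) = Module.finrank (ZMod 2) (geomTorsion W ((2 : ℕ) : ℤ)) := by
    rw [Fintype.card_fin, h2]
  have hfa2 : ∀ P, fa (fa P) = P := fun P ↦ by rw [hfa, hfa, ha2]
  have hfb2 : ∀ P, fb (fb P) = P := fun P ↦ by rw [hfb, hfb, hb2]
  let bA := basisOfLinearIndependentOfCardEqFinrank (hli fa hfa2 (by rw [hfa]; exact hu)) hcard
  let bB := basisOfLinearIndependentOfCardEqFinrank (hli fb hfb2 (by rw [hfb]; exact hu')) hcard
  have hbA0 : bA 0 = a • u + u := by rw [coe_basisOfLinearIndependentOfCardEqFinrank]; rfl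
  have hbA1 : bA 1 = u := by rw [coe_basisOfLinearIndependentOfCardEqFinrank]; rfl
  have hbB0 : bB 0 = b • u' + u' := by rw [coe_basisOfLinearIndependentOfCardEqFinrank]; rfl
  have hbB1 : bB 1 = u' := by rw [coe_basisOfLinearIndependentOfCardEqFinrank]; rfl
  -- the conjugator `M : a u + u ↦ b u' + u', u ↦ u'`
  let M : geomTorsion W ((2 : ℕ) : ℤ) ≃ₗ[ZMod 2] geomTorsion W ((2 : ℕ) : ℤ) := bA.equiv bB (Equiv.refl _)
  have hM0 : M (a • u + u) = b • u' + u' := by rw [← hbA0, Basis.equiv_apply, Equiv.refl_apply, hbB0]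
  have hM1 : M u = u' := by rw [← hbA1, Basis.equiv_apply, Equiv.refl_apply, hbB1]
  have hau : a • (a • u + u) = a • u + u := by rw [smul_add, ha2, add_comm]
  have hbu : b • (b • u' + u') = b • u' + u' := by rw [smul_add, hb2, add_comm]
  have hau' : a • u = (a • u + u) - u := by rw [add_sub_cancel_right]
  have hbu' : b • u' = (b • u' + u') - u' := by rw [add_sub_cancel_right]
  have hMA : ∀ P, M (a • P) = b • M P := by
    have hlin : M.toLinearMap ∘ₗ fa = fb ∘ₗ M.toLinearMap := by
      refine bA.ext fun i ↦ ?_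
      fin_cases i
      · change M (fa (bA 0)) = fb (M (bA 0))
        rw [hfa, hfb, hbA0, hau, hM0, hbu]
      · change M (fa (bA 1)) = fb (M (bA 1))
        rw [hfa, hfb, hbA1, hau', map_sub, hM0, hM1, ← hbu']
    intro P
    have := congrArg (fun f ↦ f P) hlin
    simpa only [LinearMap.comp_apply, LinearEquiv.coe_coe, hfa, hfb] using this
  -- lift `M` to `g ∈ Γ_ℚ`
  obtain ⟨g, hg⟩ := hsurj (Multiplicative.ofAdd M.toAddEquiv)
  have hgP : ∀ P, g • P = M P := fun P ↦ by
    have := congrArg (fun φ ↦ (Multiplicative.toAdd φ) P) hg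
    simpa using this
  refine ⟨g, fun P ↦ ?_⟩
  have hg' : g⁻¹ • P = M.symm P := by
    rw [inv_smul_eq_iff, hgP, LinearEquiv.apply_symm_apply]
  rw [hg', hgP, hMA, LinearEquiv.apply_symm_apply]

end Transpositions

/-! ## §4 Gross's (3.2) at `p = 2`, depth `1` -/

section Bridge

variable (W : WeierstrassCurve ℚ) (K : Type) [Field K] [NumberField K] [W.IsElliptic] [W.IsGloballyMinimal]

/-- **Gross's (3.2) at `p = 2`: a Zhang-Kolyvagin prime at `2` that is inert in `ℚ(√Δ_E)`
satisfies `Frob(ℓ) = Frob(∞)` in `Gal(K(E[2])/ℚ)`.** For `W/ℚ` globally minimal with `ρ̄_{E,2}`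
onto and `Δ(W) < 0`, `K` imaginary quadratic, `ℓ` a Kolyvagin prime at `2` in W. Zhang's sense
(`ℓ ∤ 2 N_E d_K`, `ℓ` inert in `K`, `2 ∣ ℓ + 1`, `2 ∣ a_ℓ`) and `Δ(W) = d·s²` with `d` a non-square
mod `ℓ`: `FrobEqFrobInfty W K 2 ℓ`. Proof: a Frobenius `h₀` above `ℓ` has `h₀² = 1` on `E[2]`
(Eichler–Shimura, `a_ℓ ≡ ℓ + 1 ≡ 0 (mod 2)`: bsd-jet `frob_smul_frob_smul_eq_self_of_dvd`) and
moves a `2`-torsion point (§2); so does a complex conjugation `c₀` (`Δ < 0`, g2's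
`exists_twoTorsion_smul_ne_of_Δ_neg`, and `c₀² = 1`); §3 conjugates `h₀` into `c₀` on `E[2]`, and
on `K` both restrict to the non-trivial automorphism (`ℓ` inert, `K` totally complex).
[cite: GrossLMS1991, §3 (3.2)–(3.3)] [cite: WZhang2014, Notations (xii)] -/
theorem frobEqFrobInfty_two_of_not_isSquare (hK : IsImaginaryQuadratic K)
    (hsurj : W.HasSurjectiveModNGaloisRep 2) (hΔneg : W.Δ < 0) {d : ℤ} {s : ℚ}
    (hΔ : W.Δ = d * s ^ 2) {ℓ : ℕ} (hns : ¬ IsSquare ((d : ℤ) : ZMod ℓ))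
    (hℓ : Zhang2014.IsKolyvaginPrime (W.conductorNorm ℤ) W K 2 ℓ) : FrobEqFrobInfty W K 2 ℓ := by
  haveI : Algebra.IsQuadraticExtension ℚ K := ⟨hK.1⟩
  haveI : IsTotallyComplex K := hK.2
  have hℓp : ℓ.Prime := hℓ.1
  haveI : Fact ℓ.Prime := ⟨hℓp⟩
  have hℓ2 : ℓ ≠ 2 := hℓ.2.2.2.1
  have hℓP : (Ideal.span {(ℓ : 𝓞 K)}).IsPrime := hℓ.2.2.2.2.1
  have hdvd := Zhang2014.IsKolyvaginPrime.dvd (p := 2) hℓ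
  -- ### places: `w = (ℓ)` in `K`, `v₁` below it in `ℚ`, a prime `𝔓 ∣ w` of `\bar ℤ_K`, `𝔓' = 𝔓 ∩ \bar ℤ`
  let w : HeightOneSpectrum (𝓞 K) := ⟨Ideal.span {(ℓ : 𝓞 K)}, hℓP, by
    rw [Ne, Ideal.span_singleton_eq_bot]; exact_mod_cast hℓp.ne_zero⟩
  have hw : (ℓ : 𝓞 K) ∈ w.asIdeal := Ideal.mem_span_singleton_self _
  set v₁ : HeightOneSpectrum (𝓞 ℚ) := w.under (𝓞 ℚ) with hv₁
  have hwv₁ : w.asIdeal.under (𝓞 ℚ) = v₁.asIdeal := rfl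
  have hℓv₁ : (ℓ : 𝓞 ℚ) ∈ v₁.asIdeal := by
    rw [← hwv₁, Ideal.under_def, Ideal.mem_comap, map_natCast]; exact hw
  have hv₁ℓ : (primesEquiv v₁ : ℕ) = ℓ := primesEquiv_eq_of_natCast_mem hℓp hℓv₁
  obtain ⟨𝔐, h𝔐⟩ := w.localPrimesAbove_nonempty
  set 𝔓 := w.primeBelow (closureEmb (K := K) (w.adicCompletion K)) 𝔐 with h𝔓def
  have h𝔓 : 𝔓 ∈ w.primesAbove := HeightOneSpectrum.primeBelow_mem_primesAbove h𝔐
  set 𝔓' := 𝔓.comap (absIntegersMap ℚ K) with h𝔓'def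
  have h𝔓' : 𝔓' ∈ v₁.primesAbove := comap_absIntegersMap_mem_primesAbove hwv₁ h𝔓
  have hgood₁ : W.HasGoodReductionAt v₁ :=
    LocalFrob.hasGoodReductionAt_rat_of_not_dvd_conductorNorm W hℓp hℓ.2.1 v₁ hℓv₁
  have hgood : W.HasGoodReductionAtPrime ℓ := (hasGoodReductionAtPrime_primesEquiv_iff_holds W v₁ ℓ hv₁ℓ).mpr hgood₁
  -- ### the two transpositions: a Frobenius `h₀` above `ℓ` and a complex conjugation `c₀`
  obtain ⟨h₀, hh₀⟩ := HeightOneSpectrum.exists_isArithFrobAt_of_mem_primesAbove_holds h𝔓'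
  obtain ⟨c₀, hc₀⟩ := exists_isComplexConjugation (Rat.castHom ℝ)
  have hne' : ((primesEquiv v₁ : Nat.Primes) : ℕ) ≠ 2 := by rw [hv₁ℓ]; exact hℓ2
  have h1' : 2 ^ 1 ∣ ((primesEquiv v₁ : Nat.Primes) : ℕ) + 1 := by rw [hv₁ℓ, pow_one]; exact hdvd.1
  have ha' : ((2 ^ 1 : ℕ) : ℤ) ∣ W.frobeniusTrace (primesEquiv v₁) := by
    rw [pow_one]
    have : ((primesEquiv v₁ : Nat.Primes) : ℕ) = ℓ := hv₁ℓ
    rw [this]; exact hdvd.2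
  have hA2 : ∀ P : geomTorsion W ((2 : ℕ) : ℤ), h₀ • h₀ • P = P := fun P ↦
    GlobalDuality.frob_smul_frob_smul_eq_self_of_dvd W 2 (k := 1) hne' hgood₁ h1' ha' ⟨𝔓', h𝔓', hh₀⟩ P
  obtain ⟨u, hu⟩ := exists_twoTorsion_smul_ne_of_isArithFrobAt W hℓ2 hgood hΔ hns hv₁ℓ h𝔓' hh₀
  have hC2 : ∀ P : geomTorsion W ((2 : ℕ) : ℤ), c₀ • c₀ • P = P := fun P ↦ by
    rw [← mul_smul, ← sq, hc₀.sq_eq_one, one_smul]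
  obtain ⟨u', hu'⟩ : ∃ v : geomTorsion W ((2 : ℕ) : ℤ), c₀ • v ≠ v := by
    obtain ⟨v, hv⟩ := exists_twoTorsion_smul_ne_of_Δ_neg W hΔneg hc₀
    exact ⟨v, hv⟩
  -- ### conjugate `h₀` into `c₀` on `E[2]`
  have hsurj' : W.HasSurjectiveModNGaloisRep ((2 : ℕ) : ℤ) := by simpa using hsurj
  obtain ⟨g, hg⟩ := exists_conj_smul_eq_of_transpositions_two W hsurj' hA2 hu hC2 hu'
  set h := g * h₀ * g⁻¹ with hhdef
  have hhP : ∀ P : geomTorsion W ((2 : ℕ) : ℤ), h • P = c₀ • P := fun P ↦ by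
    rw [hhdef, mul_smul, mul_smul]; exact hg P
  have hhFrob : IsArithFrobAt (𝓞 ℚ) h (g • 𝔓') := hh₀.conj g
  -- ### on `K`: `h` and `c₀` both restrict to the non-trivial automorphism
  letI : Algebra K (AlgebraicClosure ℚ) := (absEmbedding ℚ K).toRingHom.toAlgebra
  haveI : IsScalarTower ℚ K (AlgebraicClosure ℚ) :=
    IsScalarTower.of_algebraMap_eq fun r ↦ ((absEmbedding ℚ K).commutes r).symm
  let r : absoluteGaloisGroup ℚ →* (K ≃ₐ[ℚ] K) :=
    (AlgEquiv.restrictNormalHom K).comp (absoluteGaloisGroup.toAlgEquiv ℚ).toMonoidHom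
  have hr : ∀ (σ : absoluteGaloisGroup ℚ) (x : K), σ • absEmbedding ℚ K x = absEmbedding ℚ K (r σ x) := fun σ x ↦ by
    have := AlgEquiv.restrictNormal_commutes (absoluteGaloisGroup.toAlgEquiv ℚ σ) K x
    rw [absoluteGaloisGroup.smul_def]
    exact this.symm
  -- `r σ = 1` iff `σ ∈ res Γ_K`
  have hrange : ∀ σ : absoluteGaloisGroup ℚ, r σ = 1 → σ ∈ (absGaloisRestrict ℚ K).range := by
    intro σ hσ
    rw [mem_range_absGaloisRestrict_iff_smul_absEmbedding]
    intro x
    rw [hr, hσ, AlgEquiv.one_apply]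
  -- `r h₀ ≠ 1` (`ℓ` inert: residue degree `2`), hence `r h ≠ 1`; `r c₀ ≠ 1` (`K` totally complex)
  have hf2 := LocalFrob.inertiaDeg_eq_two_of_isPrime_span K hK.1 hℓp hℓP w hw
  have hrh₀ : r h₀ ≠ 1 := by
    intro h1
    obtain ⟨τ, hτ⟩ := MonoidHom.mem_range.mp (hrange h₀ h1)
    have hτ' : absGaloisRestrict ℚ K τ = h₀ := hτ
    have hf1 := inertiaDeg_eq_one_of_isArithFrobAt_absGaloisRestrict (F := ℚ) (M := K) hwv₁ h𝔓 (τ := τ)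
      (by rw [hτ']; exact hh₀)
    rw [hf2] at hf1
    exact absurd hf1 (by norm_num)
  have hrc₀ : r c₀ ≠ 1 := fun h1 ↦
    Rat.not_mem_range_absGaloisRestrict_of_isComplexConjugation K hK.2 hc₀ (hrange c₀ h1)
  have hcard : Nat.card (K ≃ₐ[ℚ] K) = 2 := by rw [IsGalois.card_aut_eq_finrank, hK.1]
  obtain ⟨y, -, hy⟩ := (Nat.card_eq_two_iff' (1 : K ≃ₐ[ℚ] K)).mp hcard
  have hrh : r h = y := by
    have hrh0 : r h₀ = y := hy _ hrh₀
    rw [hhdef, map_mul, map_mul, map_inv, hrh0]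
    by_cases hrg : r g = 1
    · rw [hrg, one_mul, inv_one, mul_one]
    · rw [hy _ hrg, mul_inv_cancel_right]
  have hmem : c₀⁻¹ * h ∈ (absGaloisRestrict ℚ K).range := by
    refine hrange _ ?_
    rw [map_mul, map_inv, hrh, hy _ hrc₀, inv_mul_cancel]
  obtain ⟨τ, hτ⟩ := MonoidHom.mem_range.mp hmem
  have hτ' : absGaloisRestrict ℚ K τ = c₀⁻¹ * h := hτ
  -- ### assemble (3.2)
  refine ⟨v₁, g • 𝔓', h, c₀, hℓv₁, smul_mem_primesAbove h𝔓' g, hhFrob, hc₀, hhP, fun e x ↦ ?_⟩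
  have hh' : h = c₀ * absGaloisRestrict ℚ K τ := by rw [hτ', mul_inv_cancel_left]
  rw [hh', mul_smul, absGaloisRestrict_smul_apply_eq τ e x]

end Bridge

/-! ## §5 On the habitat H₂ of route CMKolyvaginAtInertTwo -/

section Habitat

variable (W : WeierstrassCurve ℚ) (K : Type) [Field K] [NumberField K] [W.IsElliptic] [W.IsGloballyMinimal]

omit [W.IsGloballyMinimal] in
/-- **On H₂, `Δ = d_F · s²` with `d_F < 0`.** For `W/ℚ` with CM, `2` inert in the CM field `F`
(`CMInert W 2`, `d_F = cmFieldDiscrOfJ j(W)`) and `ρ̄_{W,2}` onto: `Δ(W) = d_F·s²` for some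
`s ∈ ℚ`, and `d_F < 0` — lit g11's `exists_Δ_eq_mul_sq_of_cmInert_two` (`Δ = ±d_F·s²`) with the
sign fixed by g2's `Δ_neg_of_cmInert_two` (`Δ < 0`; `d_F ∈ {−3, −11, −19, −43, −67, −163}`).
[cite: SilvermanATAEC1994, App. A §3 (table of CM j-invariants)] [cite: SilvermanAEC2009, III.1] -/
theorem exists_Δ_eq_cmFieldDiscr_mul_sq_of_cmInert_two (hCM : W.HasCM) (hin : CMInert W 2)
    (hsurj : W.HasSurjectiveModNGaloisRep 2) :
    cmFieldDiscrOfJ W.j < 0 ∧ ∃ s : ℚ, W.Δ = cmFieldDiscrOfJ W.j * s ^ 2 := by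
  have hΔneg := Δ_neg_of_cmInert_two W hCM hin hsurj
  obtain ⟨d, hd, s, hs⟩ := exists_Δ_eq_mul_sq_of_cmInert_two W hin
  have hdneg : (d : ℚ) < 0 := by
    by_contra h
    push Not at h
    have : (0 : ℚ) ≤ d * s ^ 2 := mul_nonneg h (sq_nonneg s)
    linarith
  have hdneg' : d < 0 := by exact_mod_cast hdneg
  have hDF : cmFieldDiscrOfJ W.j < 0 := by
    rcases j_mem_of_cmInert_two W hin with hj | hj | hj | hj | hj | hj | hj | hj <;>
      · rw [hj]; unfold cmFieldDiscrOfJ; norm_num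
  rcases hd with hd | hd
  · exact ⟨hDF, s, by rw [← hd]; exact hs⟩
  · exfalso; rw [hd] at hdneg'; linarith

omit [W.IsGloballyMinimal] in
/-- **`CMInert W ℓ` at an odd prime `ℓ` says `d_F` is a non-square mod `ℓ`** (unfolding the
tree predicates `CMInert = ¬CMRamified ∧ ¬CMSplit` of `Rank1Residual/Predicates.lean`: `ℓ ∤ d_F` and
not (`ℓ ∤ d_F ∧ IsSquare (d_F : ZMod ℓ)`)). [folklore] -/
theorem not_isSquare_cmFieldDiscr_of_cmInert {ℓ : ℕ} (hℓ2 : ℓ ≠ 2) (hin : CMInert W ℓ) :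
    ¬ IsSquare ((cmFieldDiscrOfJ W.j : ℤ) : ZMod ℓ) := by
  intro hsq
  obtain ⟨hram, hsplit⟩ := hin
  apply hsplit
  refine ⟨hram, ?_⟩
  rw [if_neg hℓ2]
  exact hsq

/-- **THE BRIDGE ON H₂ (depth 1): the route's typed Kolyvagin primes are Gross's.** For `W/ℚ`
globally minimal with CM, `2` inert in `F = Frac End E` (`CMInert W 2`), `ρ̄_{E,2}` onto, `K`
imaginary quadratic, and `ℓ` with `Zhang2014.IsKolyvaginPrime (N_E) W K 2 ℓ ∧ CMInert W ℓ`
(the conjunct of cruxes 24276/24277, rev 8): `Frob(ℓ) = Frob(∞)` in `Gal(K(E[2])/ℚ)`, i.e.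
`FrobEqFrobInfty W K (2^1) ℓ` — the predicate consumed by the tree's Kolyvagin machine at level
`p^M`, `M = 1`. [cite: GrossLMS1991, §3 (3.2)–(3.3)] [cite: WZhang2014, Notations (xii)] -/
theorem frobEqFrobInfty_two_of_cmInert (hK : IsImaginaryQuadratic K) (hCM : W.HasCM)
    (hin : CMInert W 2) (hsurj : W.HasSurjectiveModNGaloisRep 2) {ℓ : ℕ}
    (hℓ : Zhang2014.IsKolyvaginPrime (W.conductorNorm ℤ) W K 2 ℓ) (hinℓ : CMInert W ℓ) :
    FrobEqFrobInfty W K (2 ^ 1) ℓ := by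
  rw [pow_one]
  obtain ⟨_, s, hs⟩ := exists_Δ_eq_cmFieldDiscr_mul_sq_of_cmInert_two W hCM hin hsurj
  exact frobEqFrobInfty_two_of_not_isSquare W K hK hsurj (Δ_neg_of_cmInert_two W hCM hin hsurj) hs
    (not_isSquare_cmFieldDiscr_of_cmInert W hℓ.2.2.2.1 hinℓ) hℓ

/-- **The route's typed Kolyvagin primes at `2` are Gross's Kolyvagin primes at level `2¹`** on H₂:
`Zhang2014.IsKolyvaginPrime (N_E) W K 2 ℓ ∧ CMInert W ℓ → IsKolyvaginPrime (N_E) W K (2^1) ℓ`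
(Gross 1991 §3: (3.1) `ℓ ∤ N·d_K·p`, `λ = (ℓ)` inert, and (3.2)). The `p = 2` counterpart of
`AdditiveKoly.isKolyvaginPrime_pow_one_of_zhang`. [cite: GrossLMS1991, §3 (3.1)–(3.3)]
[cite: WZhang2014, Notations (xii)] -/
theorem isKolyvaginPrime_two_pow_one_of_cmInert (hK : IsImaginaryQuadratic K) (hCM : W.HasCM)
    (hin : CMInert W 2) (hsurj : W.HasSurjectiveModNGaloisRep 2) {ℓ : ℕ}
    (hℓ : Zhang2014.IsKolyvaginPrime (W.conductorNorm ℤ) W K 2 ℓ) (hinℓ : CMInert W ℓ) :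
    IsKolyvaginPrime (W.conductorNorm ℤ) W K (2 ^ 1) ℓ :=
  ⟨hℓ.1, hℓ.2.1, hℓ.2.2.1, by rw [pow_one]; exact hℓ.2.2.2.1, hℓ.2.2.2.2.1,
    frobEqFrobInfty_two_of_cmInert W K hK hCM hin hsurj hℓ hinℓ⟩

end Habitat


end Summit.BirchSwinnertonDyer.BirchSwinnertonDyer.Theorems.KolyvaginFrobeniusTwo

end
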